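import Literature.NumberTheory.EllipticCurves.ComplexMultiplicationHasCMProofs
import HarnessLib

/-!
# Transport of the geometric endomorphism ring `End_{K̄}(E)` along `K̄`-isomorphisms

Topic `NumberTheory/EllipticCurves`; a proofs-only file (theorems only, no definitions, no named
facts), sibling of the prelude `Isogeny.lean` (`WeierstrassCurve.geomEndRing = End_{K̄}(E)`, the
subring of `AddMonoid.End E(K̄)` generated by the algebraic additive maps) and of
`ComplexMultiplicationHasCMProofs.lean`, which transports the *predicate* `HasCM` along a
`K̄`-isomorphism `C • W₁ = W₂` (`HasCM.of_variableChange_baseChange`).  Here the whole ring is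
transported:

* `WeierstrassCurve.exists_ringEquiv_geomEndRing_of_addEquiv` — an additive isomorphism
  `ι : E₁(K̄) ≃+ E₂(K̄)` which is algebraic in both directions conjugates `End_{K̄}(E₂)` onto
  `End_{K̄}(E₁)`: a ring isomorphism `e : W₂.geomEndRing ≃+* W₁.geomEndRing` with
  `e φ = ι⁻¹ ∘ φ ∘ ι` (conjugation is a ring isomorphism of `AddMonoid.End`, and it maps the
  generating set of algebraic maps into algebraic maps, `IsAlgebraicOn.comp`);
* `WeierstrassCurve.exists_ringEquiv_geomEndRing_of_variableChange` — the case of the substitution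
  isomorphism of a change of variables `C` over `K̄` with `C • W₁ = W₂` (Silverman, *AEC*, III.1,
  Table 3.1; the tree's `isAlgebraicOn_pointEquiv_trans_congrEquiv{,_symm}`), with the consequence
  that **kernels correspond**: `#ker (e φ) = #ker φ`;
* `WeierstrassCurve.exists_ringEquiv_geomEndRing_of_j_eq` — **`End_{K̄}(E)` with its degree
  function `φ ↦ #ker φ` depends only on `j(E)`** (elliptic curves with the same `j` are
  `K̄`-isomorphic: Silverman, *AEC*, III.1.4(b); Mathlib `exists_variableChange_of_j_eq`).

Silverman, *AEC*, III.§4, III.§9: `End(E)` is an invariant of the `K̄`-isomorphism class of `E`.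

## References

* J. H. Silverman, *The Arithmetic of Elliptic Curves*, 2nd ed., GTM 106 (2009), III.1
  (Table 3.1), Prop. III.1.4(b), III.§4. [SilvermanAEC2009]
-/

noncomputable section

open scoped Classical

universe u

namespace WeierstrassCurve

variable {K : Type u} [Field K] {W₁ W₂ : WeierstrassCurve K}

/-- **Conjugation by a bi-algebraic isomorphism of geometric points identifies the geometric
endomorphism rings.**  For an additive isomorphism `ι : E₁(K̄) ≃+ E₂(K̄)` such that `ι` and `ι⁻¹`
are algebraic maps (`IsAlgebraicOn`), there is a ring isomorphism
`e : End_{K̄}(E₂) ≃+* End_{K̄}(E₁)` with `e φ = ι⁻¹ ∘ φ ∘ ι`.  (Conjugation `φ ↦ ι⁻¹φι` is a ring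
isomorphism `AddMonoid.End E₂(K̄) ≃ AddMonoid.End E₁(K̄)` carrying the generators — algebraic
additive maps — of `W₂.geomEndRing` to generators of `W₁.geomEndRing` by `IsAlgebraicOn.comp`,
and conversely.) Silverman, *AEC*, III.§4. [cite: SilvermanAEC2009, III.§4 (the ring End(E) = Hom(E, E))] -/
theorem exists_ringEquiv_geomEndRing_of_addEquiv (ι : W₁.geomPoints ≃+ W₂.geomPoints)
    (hι : IsAlgebraicOn W₁ W₂ ι) (hι' : IsAlgebraicOn W₂ W₁ ι.symm) :
    ∃ e : W₂.geomEndRing ≃+* W₁.geomEndRing, ∀ (φ : W₂.geomEndRing) (P : W₁.geomPoints),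
      (e φ : AddMonoid.End W₁.geomPoints) P = ι.symm ((φ : AddMonoid.End W₂.geomPoints) (ι P)) := by
  -- conjugation and its inverse on the full endomorphism rings
  let c : AddMonoid.End W₂.geomPoints → AddMonoid.End W₁.geomPoints :=
    fun φ ↦ ι.symm.toAddMonoidHom.comp ((φ : W₂.geomPoints →+ W₂.geomPoints).comp ι.toAddMonoidHom)
  let c' : AddMonoid.End W₁.geomPoints → AddMonoid.End W₂.geomPoints :=
    fun ψ ↦ ι.toAddMonoidHom.comp ((ψ : W₁.geomPoints →+ W₁.geomPoints).comp ι.symm.toAddMonoidHom)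
  have hc_apply : ∀ φ P, c φ P = ι.symm (φ (ι P)) := fun φ P ↦ rfl
  have hcc' : ∀ ψ, c (c' ψ) = ψ := fun ψ ↦ by
    refine AddMonoidHom.ext fun P ↦ ?_
    change ι.symm (ι (ψ (ι.symm (ι P)))) = ψ P
    rw [ι.symm_apply_apply, ι.symm_apply_apply]
  have hc'c : ∀ φ, c' (c φ) = φ := fun φ ↦ by
    refine AddMonoidHom.ext fun Q ↦ ?_
    change ι (ι.symm (φ (ι (ι.symm Q)))) = φ Q
    rw [ι.apply_symm_apply, ι.apply_symm_apply]
  have hc_one : c 1 = 1 := AddMonoidHom.ext fun P ↦ by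
    change ι.symm (ι P) = P
    exact ι.symm_apply_apply P
  have hc_mul : ∀ φ ψ, c (φ * ψ) = c φ * c ψ := fun φ ψ ↦ AddMonoidHom.ext fun P ↦ by
    change ι.symm (φ (ψ (ι P))) = ι.symm (φ (ι (ι.symm (ψ (ι P)))))
    rw [ι.apply_symm_apply]
  have hc_zero : c 0 = 0 := AddMonoidHom.ext fun P ↦ by
    change ι.symm 0 = 0
    exact map_zero _
  have hc_add : ∀ φ ψ, c (φ + ψ) = c φ + c ψ := fun φ ψ ↦ AddMonoidHom.ext fun P ↦ by
    change ι.symm (φ (ι P) + ψ (ι P)) = ι.symm (φ (ι P)) + ι.symm (ψ (ι P))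
    exact map_add _ _ _
  -- conjugation respects the geometric endomorphism rings
  have hcS : ∀ φ, φ ∈ W₂.geomEndRing → c φ ∈ W₁.geomEndRing := by
    let cR : AddMonoid.End W₂.geomPoints →+* AddMonoid.End W₁.geomPoints :=
      { toFun := c, map_one' := hc_one, map_mul' := hc_mul, map_zero' := hc_zero, map_add' := hc_add }
    have hsub : {φ : AddMonoid.End W₂.geomPoints | IsAlgebraicOn W₂ W₂ φ} ⊆
        ((W₁.geomEndRing.comap cR : Subring (AddMonoid.End W₂.geomPoints)) :
          Set (AddMonoid.End W₂.geomPoints)) := by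
      intro φ hφ
      rw [SetLike.mem_coe, Subring.mem_comap]
      refine Subring.subset_closure ?_
      have h1 : IsAlgebraicOn W₁ W₂ (fun P ↦ (φ : W₂.geomPoints →+ W₂.geomPoints)
          (ι.toAddMonoidHom P)) :=
        IsAlgebraicOn.comp (W := W₁) (W' := W₂) (W'' := W₂) (f := φ) (g := ι.toAddMonoidHom) hφ hι
      exact IsAlgebraicOn.comp (W := W₁) (W' := W₂) (W'' := W₁) (f := ι.symm.toAddMonoidHom)
        (g := (φ : W₂.geomPoints →+ W₂.geomPoints).comp ι.toAddMonoidHom) hι' h1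
    intro φ hφ
    have := (Subring.closure_le.2 hsub) hφ
    rw [Subring.mem_comap] at this
    exact this
  have hc'S : ∀ ψ, ψ ∈ W₁.geomEndRing → c' ψ ∈ W₂.geomEndRing := by
    have hc'_one : c' 1 = 1 := by rw [← hc_one, hc'c]
    have hc'_mul : ∀ φ ψ, c' (φ * ψ) = c' φ * c' ψ := fun φ ψ ↦ by
      rw [← hc'c (c' φ * c' ψ), hc_mul, hcc', hcc']
    have hc'_zero : c' 0 = 0 := by rw [← hc_zero, hc'c]
    have hc'_add : ∀ φ ψ, c' (φ + ψ) = c' φ + c' ψ := fun φ ψ ↦ by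
      rw [← hc'c (c' φ + c' ψ), hc_add, hcc', hcc']
    let cR' : AddMonoid.End W₁.geomPoints →+* AddMonoid.End W₂.geomPoints :=
      { toFun := c', map_one' := hc'_one, map_mul' := hc'_mul, map_zero' := hc'_zero,
        map_add' := hc'_add }
    have hsub : {ψ : AddMonoid.End W₁.geomPoints | IsAlgebraicOn W₁ W₁ ψ} ⊆
        ((W₂.geomEndRing.comap cR' : Subring (AddMonoid.End W₁.geomPoints)) :
          Set (AddMonoid.End W₁.geomPoints)) := by
      intro ψ hψ
      rw [SetLike.mem_coe, Subring.mem_comap]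
      refine Subring.subset_closure ?_
      have h1 : IsAlgebraicOn W₂ W₁ (fun Q ↦ (ψ : W₁.geomPoints →+ W₁.geomPoints)
          (ι.symm.toAddMonoidHom Q)) :=
        IsAlgebraicOn.comp (W := W₂) (W' := W₁) (W'' := W₁) (f := ψ) (g := ι.symm.toAddMonoidHom)
          hψ hι'
      exact IsAlgebraicOn.comp (W := W₂) (W' := W₁) (W'' := W₂) (f := ι.toAddMonoidHom)
        (g := (ψ : W₁.geomPoints →+ W₁.geomPoints).comp ι.symm.toAddMonoidHom) hι h1
    intro ψ hψ
    have := (Subring.closure_le.2 hsub) hψ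
    rw [Subring.mem_comap] at this
    exact this
  -- the ring isomorphism
  refine ⟨{ toFun := fun φ ↦ ⟨c φ, hcS φ φ.2⟩
            invFun := fun ψ ↦ ⟨c' ψ, hc'S ψ ψ.2⟩
            left_inv := fun φ ↦ Subtype.ext (hc'c φ)
            right_inv := fun ψ ↦ Subtype.ext (hcc' ψ)
            map_mul' := fun φ ψ ↦ Subtype.ext (hc_mul φ ψ)
            map_add' := fun φ ψ ↦ Subtype.ext (hc_add φ ψ) }, fun φ P ↦ rfl⟩

/-- **`End_{K̄}(E)` along a change of variables over `K̄`.**  If `C • W₁ = W₂` over `K̄`, the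
substitution isomorphism `ι : E₁(K̄) ≃+ E₂(K̄)`, `(x, y) ↦ (u⁻²(x − r), u⁻³(y − s(x − r) − t))`
(Silverman, *AEC*, III.1 Table 3.1; algebraic in both directions) conjugates `End_{K̄}(E₂)` onto
`End_{K̄}(E₁)`, and the kernels of `φ` and of its conjugate `ι⁻¹φι` have the same cardinality
(`ι` restricts to a bijection between them). [cite: SilvermanAEC2009, III.1 Table 3.1 and III.§4] -/
theorem exists_ringEquiv_geomEndRing_of_variableChange (C : VariableChange (AlgebraicClosure K))
    (h : C • W₁.baseChange (AlgebraicClosure K) = W₂.baseChange (AlgebraicClosure K)) :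
    ∃ e : W₂.geomEndRing ≃+* W₁.geomEndRing, ∀ φ : W₂.geomEndRing,
      Nat.card (AddMonoidHom.ker ((e φ : AddMonoid.End W₁.geomPoints) :
          W₁.geomPoints →+ W₁.geomPoints)) =
        Nat.card (AddMonoidHom.ker ((φ : AddMonoid.End W₂.geomPoints) :
          W₂.geomPoints →+ W₂.geomPoints)) := by
  set ι : W₁.geomPoints ≃+ W₂.geomPoints :=
    (VariableChange.pointEquiv (W₁.baseChange (AlgebraicClosure K)) C).trans
      (Affine.Point.congrEquiv h) with hι
  obtain ⟨e, he⟩ := exists_ringEquiv_geomEndRing_of_addEquiv ι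
    (isAlgebraicOn_pointEquiv_trans_congrEquiv C h) (isAlgebraicOn_pointEquiv_trans_congrEquiv_symm C h)
  refine ⟨e, fun φ ↦ Nat.card_congr (ι.toEquiv.subtypeEquiv fun P ↦ ?_)⟩
  change (e φ : AddMonoid.End W₁.geomPoints) P = 0 ↔ (φ : AddMonoid.End W₂.geomPoints) (ι P) = 0
  rw [he φ P, ι.symm.map_eq_zero_iff]

/-- **`End_{K̄}(E)`, with the degrees `#ker φ`, depends only on the `j`-invariant.**  Two elliptic
curves over `K` with the same `j`-invariant are isomorphic over `K̄` (Silverman, *AEC*,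
Prop. III.1.4(b); Mathlib `exists_variableChange_of_j_eq` over the separably closed `K̄`), and a
`K̄`-isomorphism conjugates the geometric endomorphism rings, preserving kernel cardinalities.
[cite: SilvermanAEC2009, Prop. III.1.4(b) and III.§4] -/
theorem exists_ringEquiv_geomEndRing_of_j_eq {V₁ V₂ : WeierstrassCurve K} [V₁.IsElliptic]
    [V₂.IsElliptic] (hj : V₁.j = V₂.j) :
    ∃ e : V₂.geomEndRing ≃+* V₁.geomEndRing, ∀ φ : V₂.geomEndRing,
      Nat.card (AddMonoidHom.ker ((e φ : AddMonoid.End V₁.geomPoints) :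
          V₁.geomPoints →+ V₁.geomPoints)) =
        Nat.card (AddMonoidHom.ker ((φ : AddMonoid.End V₂.geomPoints) :
          V₂.geomPoints →+ V₂.geomPoints)) := by
  obtain ⟨C, hC⟩ := exists_variableChange_of_j_eq (V₁.baseChange (AlgebraicClosure K))
    (V₂.baseChange (AlgebraicClosure K)) (by simp only [baseChange, map_j, hj])
  exact exists_ringEquiv_geomEndRing_of_variableChange C hC

end WeierstrassCurve

end
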